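import Summits.AtomisticToContinuum.BoseEinsteinCondensation.Theorems.BECThomsonPrincipleGDTransferDefs
import Summits.AtomisticToContinuum.BoseEinsteinCondensation.Theorems.BECThomsonPrincipleGDTransferChordVariationSrcPair
import Summits.AtomisticToContinuum.BoseEinsteinCondensation.Theorems.BECThomsonPrincipleGDTransferChordVariationForms

/-!
# Route `BECThomsonPrinciple`, crux `GDTransfer` (stmt-AtomisticToContinuum-9482), line `dyson-dressed-witness`:
# stub `chordVariation`, part 3 — Gaussian domination differentiated along `Ψ ± tζ`

Support file of `stub_chordVariation` (`GaussianDominationCan → TwoSidedDualNorm`); the place where the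
antecedent is consumed.  (i) `gd_direction`: the square form of GD (`Negative.forall_gdIneq_iff`) at the
normalisation `f/‖f‖` (`PeriodicTrialState.ofFun`) of an arbitrary direction `f` of finite energy form
reads, homogeneously, `(N|σ(f,f)|)² ≤ C_k ‖f‖² q̃(f)`, `q̃ = 𝓔 − E₀‖·‖²`, `C_k = CL²/‖n‖²` (also for
`‖f‖ = 0`, where both sides vanish).  (ii) `variation_estimate` — the SYMMETRISED variational
Kennedy–Lieb–Shastry step: apply (i) to the two chords `Ψ + tζ` and `Ψ − tζ` (`t > 0`) of a trial state
`Ψ` and a direction `ζ`, add, and use three parallelogram laws — for `𝓔`, for the mass, and for the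
quadratic polynomial `t ↦ σ(Ψ+tζ, Ψ+tζ) = σ₀ + tA₁ + t²A₂` in `ℂ` (`|σ₊|² + |σ₋|² ≥ 2t²|A₁|²`):
`(N|A₁|)² ≤ C_k μ̄ q̃(ζ) + C_k μ̄ q̃(Ψ)/t²`, `A₁ = σ(ζ,Ψ) + σ(Ψ,ζ)`, `μ̄ = 1 + t + (t + t²)‖ζ‖²`
(`kls_arith` is the real-arithmetic step).  No Cauchy–Schwarz and no a-priori bound on `σ` is needed.
All [folklore] (KennedyLiebShastry1988, variational form).
-/

noncomputable section

open MeasureTheory Filter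
open scoped ENNReal NNReal ComplexConjugate

namespace Summit.AtomisticToContinuum.BoseEinsteinCondensation.Cruxes.GDTransfer.DysonDressedWitness

namespace ChordVariation

open Literature.MathematicalPhysics.QuantumManyBody.BoseGas
open Summit.AtomisticToContinuum.BoseEinsteinCondensation.Theorems.GaussianDominationCan.Negative

variable {m : ℕ} {L : ℝ} {v : ℝ → ℝ≥0∞} {n : Fin 3 → ℤ} {C : ℝ}

/-! ## Gaussian domination at a direction (homogeneous square form) -/

/-- **GD at a direction.** If `GDIneq` holds for all `s ≥ 0` and all trial states, then for every
direction `f` of finite energy form `(N|σ(f,f)|)² ≤ C_k · ‖f‖² · (𝓔(f) − E₀‖f‖²)` in real numbers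
(normalise `f` with `PeriodicTrialState.ofFun` and use `Negative.forall_gdIneq_iff`; both sides vanish
when `‖f‖ = 0`). [folklore] -/
theorem gd_direction
    (hGD : ∀ s : ℝ, 0 ≤ s → ∀ Φ : PeriodicTrialState (m + 1) L, GDIneq v m L n C s Φ)
    (hC : 0 < C) (hL : 0 < L) (hn : n ≠ 0) {f : Config (m + 1) → ℂ} (hf : IsDirection m L f)
    (hfin : eform v L f ≠ ⊤) :
    (((m + 1 : ℕ) : ℝ) * ‖srcPair m L n f f‖) ^ 2 ≤
      C * L ^ 2 / ‖(fun j => (n j : ℝ))‖ ^ 2 * (mass L f).toReal *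
        ((eform v L f).toReal - (periodicGroundStateEnergy v (m + 1) L).toReal * (mass L f).toReal) := by
  by_cases h0 : mass L f = 0
  · rw [srcPair_self_eq_zero_of_mass_eq_zero n hf.contDiff.continuous h0, h0]
    simp
  have htop : mass L f ≠ ⊤ := mass_ne_top_of_continuous hf.contDiff.continuous
  set Γ : ℝ := C * L ^ 2 / ‖(fun j => (n j : ℝ))‖ ^ 2 with hΓ
  set Φ : PeriodicTrialState (m + 1) L :=
    PeriodicTrialState.ofFun f hf.contDiff hf.periodic hf.symm h0 htop with hΦdef
  set μ : ℝ := (mass L f).toReal with hμdef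
  have hμ : 0 < μ := ENNReal.toReal_pos h0 htop
  set a : ℂ := ((Real.sqrt μ)⁻¹ : ℂ) with ha_def
  have hΦψ : Φ.ψ = fun X => a * f X := rfl
  have ha2 : ‖a‖ ^ 2 = μ⁻¹ := by
    rw [ha_def, norm_inv, Complex.norm_real, Real.norm_of_nonneg (Real.sqrt_nonneg _), inv_pow,
      Real.sq_sqrt hμ.le]
  have ha_enn : (‖a‖₊ : ℝ≥0∞) ^ 2 = (mass L f)⁻¹ := by
    rw [coe_nnnorm_sq_eq_ofReal, ha2, ENNReal.ofReal_inv_of_pos hμ, hμdef,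
      ENNReal.ofReal_toReal htop]
  have hE : periodicEnergy v Φ = (mass L f)⁻¹ * eform v L f := by
    rw [← eform_trialState, hΦψ, eform_smul v a hf.contDiff, ha_enn]
  have hEtop : periodicEnergy v Φ ≠ ⊤ := by
    rw [hE]; exact ENNReal.mul_ne_top (ENNReal.inv_ne_top.mpr h0) hfin
  have hsq := (forall_gdIneq_iff hC hL hn Φ).mp (fun s hs => hGD s hs Φ) hEtop
  have hS : sourceIntegral m L n Φ.ψ = conj a * a * srcPair m L n f f := by
    rw [← srcPair_self, hΦψ, srcPair_const_mul_left, srcPair_const_mul_right, mul_assoc]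
  have hnS : ‖sourceIntegral m L n Φ.ψ‖ = μ⁻¹ * ‖srcPair m L n f f‖ := by
    rw [hS, norm_mul, norm_mul, Complex.norm_conj, ← sq, ha2]
  have hE0le : periodicGroundStateEnergy v (m + 1) L ≤ periodicEnergy v Φ :=
    periodicGroundStateEnergy_le v Φ
  have hdiff : (periodicEnergy v Φ - periodicGroundStateEnergy v (m + 1) L).toReal =
      μ⁻¹ * (eform v L f).toReal - (periodicGroundStateEnergy v (m + 1) L).toReal := by
    rw [ENNReal.toReal_sub_of_le hE0le hEtop, hE, ENNReal.toReal_mul, ENNReal.toReal_inv]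
  rw [hnS, hdiff, ← hΓ] at hsq
  have hcast : ((m + 1 : ℕ) : ℝ) = (m : ℝ) + 1 := by push_cast; ring
  rw [hcast]
  have hμ0 : μ ≠ 0 := hμ.ne'
  have key : (((m : ℝ) + 1) * ‖srcPair m L n f f‖) ^ 2 =
      μ ^ 2 * (((m : ℝ) + 1) * (μ⁻¹ * ‖srcPair m L n f f‖)) ^ 2 := by
    field_simp
  rw [key]
  calc μ ^ 2 * (((m : ℝ) + 1) * (μ⁻¹ * ‖srcPair m L n f f‖)) ^ 2
      ≤ μ ^ 2 * (Γ * (μ⁻¹ * (eform v L f).toReal -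
          (periodicGroundStateEnergy v (m + 1) L).toReal)) :=
        mul_le_mul_of_nonneg_left hsq (sq_nonneg _)
    _ = Γ * μ * ((eform v L f).toReal - (periodicGroundStateEnergy v (m + 1) L).toReal * μ) := by
        field_simp

/-! ## The symmetrised variation -/

/-- Real-arithmetic core of the symmetrised variation: from the two homogeneous GD inequalities at
`Ψ ± tζ`, the two parallelogram laws and `|σ₊|² + |σ₋|² ≥ 2t²|A₁|²` to the bound on `(N|A₁|)²`.
[folklore] -/
theorem kls_arith {N Γ t μp μm ep em Eψ eζ mζ e₀ Sp Sm A : ℝ} (ht : 0 < t) (hΓ : 0 ≤ Γ)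
    (h1 : ep + em = 2 * Eψ + 2 * t ^ 2 * eζ) (h2 : μp + μm = 2 + 2 * t ^ 2 * mζ)
    (h3p : μp ≤ (1 + t) + (t + t ^ 2) * mζ) (h3m : μm ≤ (1 + t) + (t + t ^ 2) * mζ)
    (h4p : e₀ * μp ≤ ep) (h4m : e₀ * μm ≤ em)
    (h6p : (N * Sp) ^ 2 ≤ Γ * μp * (ep - e₀ * μp))
    (h6m : (N * Sm) ^ 2 ≤ Γ * μm * (em - e₀ * μm))
    (h7 : 2 * t ^ 2 * (N * A) ^ 2 ≤ (N * Sp) ^ 2 + (N * Sm) ^ 2) :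
    (N * A) ^ 2 ≤ Γ * ((1 + t) + (t + t ^ 2) * mζ) * (eζ - e₀ * mζ) +
      Γ * ((1 + t) + (t + t ^ 2) * mζ) * (Eψ - e₀) / t ^ 2 := by
  set μb := (1 + t) + (t + t ^ 2) * mζ with hμb
  have hQp : 0 ≤ ep - e₀ * μp := by linarith
  have hQm : 0 ≤ em - e₀ * μm := by linarith
  have h6p' : (N * Sp) ^ 2 ≤ Γ * μb * (ep - e₀ * μp) :=
    h6p.trans (mul_le_mul_of_nonneg_right (mul_le_mul_of_nonneg_left h3p hΓ) hQp)
  have h6m' : (N * Sm) ^ 2 ≤ Γ * μb * (em - e₀ * μm) :=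
    h6m.trans (mul_le_mul_of_nonneg_right (mul_le_mul_of_nonneg_left h3m hΓ) hQm)
  have hsum : (ep - e₀ * μp) + (em - e₀ * μm) = 2 * ((Eψ - e₀) + t ^ 2 * (eζ - e₀ * mζ)) := by
    linear_combination h1 - e₀ * h2
  have hmain : 2 * t ^ 2 * (N * A) ^ 2 ≤ Γ * μb * (2 * ((Eψ - e₀) + t ^ 2 * (eζ - e₀ * mζ))) := by
    calc 2 * t ^ 2 * (N * A) ^ 2 ≤ (N * Sp) ^ 2 + (N * Sm) ^ 2 := h7
      _ ≤ Γ * μb * (ep - e₀ * μp) + Γ * μb * (em - e₀ * μm) := add_le_add h6p' h6m'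
      _ = Γ * μb * (2 * ((Eψ - e₀) + t ^ 2 * (eζ - e₀ * mζ))) := by rw [← mul_add, hsum]
  have ht2 : (0 : ℝ) < 2 * t ^ 2 := by positivity
  have hdiv : (N * A) ^ 2 = (2 * t ^ 2 * (N * A) ^ 2) / (2 * t ^ 2) := by
    field_simp
  rw [hdiv]
  calc 2 * t ^ 2 * (N * A) ^ 2 / (2 * t ^ 2)
      ≤ Γ * μb * (2 * ((Eψ - e₀) + t ^ 2 * (eζ - e₀ * mζ))) / (2 * t ^ 2) :=
        div_le_div_of_nonneg_right hmain ht2.le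
    _ = Γ * μb * (eζ - e₀ * mζ) + Γ * μb * (Eψ - e₀) / t ^ 2 := by
        have ht0 : t ≠ 0 := ht.ne'
        field_simp
        ring

/-- **The symmetrised variational KLS step.** For a trial state `Ψ` of finite energy, a direction `ζ`
of finite energy form and `t > 0`, with `A₁ = σ(ζ,Ψ) + σ(Ψ,ζ)`, `μ̄ = 1 + t + (t + t²)‖ζ‖²`,
`C_k = CL²/‖n‖²`: `(N|A₁|)² ≤ C_k μ̄ q̃(ζ) + C_k μ̄ (E(Ψ) − E₀)/t²`. [folklore] -/
theorem variation_estimate (hv : Measurable v)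
    (hGD : ∀ s : ℝ, 0 ≤ s → ∀ Φ : PeriodicTrialState (m + 1) L, GDIneq v m L n C s Φ)
    (hC : 0 < C) (hL : 0 < L) (hn : n ≠ 0) (Ψ : PeriodicTrialState (m + 1) L)
    (hΨ : periodicEnergy v Ψ ≠ ⊤) {ζ : Config (m + 1) → ℂ} (hζ : IsDirection m L ζ)
    (hζfin : eform v L ζ ≠ ⊤) {t : ℝ} (ht : 0 < t) :
    (((m + 1 : ℕ) : ℝ) * ‖srcPair m L n ζ Ψ.ψ + srcPair m L n Ψ.ψ ζ‖) ^ 2 ≤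
      C * L ^ 2 / ‖(fun j => (n j : ℝ))‖ ^ 2 * ((1 + t) + (t + t ^ 2) * (mass L ζ).toReal) *
          ((eform v L ζ).toReal -
            (periodicGroundStateEnergy v (m + 1) L).toReal * (mass L ζ).toReal) +
        C * L ^ 2 / ‖(fun j => (n j : ℝ))‖ ^ 2 * ((1 + t) + (t + t ^ 2) * (mass L ζ).toReal) *
            ((periodicEnergy v Ψ).toReal - (periodicGroundStateEnergy v (m + 1) L).toReal) /
          t ^ 2 := by
  have hΓ0 : 0 ≤ C * L ^ 2 / ‖(fun j => (n j : ℝ))‖ ^ 2 := by positivity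
  have hψd : IsDirection m L Ψ.ψ := isDirection_trialState Ψ
  have hψc : Continuous Ψ.ψ := Ψ.contDiff.continuous
  have hζc : Continuous ζ := hζ.contDiff.continuous
  -- the two chords
  set gp : Config (m + 1) → ℂ := fun X => Ψ.ψ X + (t : ℂ) * ζ X with hgp
  set gm : Config (m + 1) → ℂ := fun X => Ψ.ψ X - (t : ℂ) * ζ X with hgm
  have hgpd : IsDirection m L gp := dir_add hψd (dir_const_mul hζ _)
  have hgmd : IsDirection m L gm := dir_sub hψd (dir_const_mul hζ _)
  -- parallelogram laws in `ℝ≥0∞`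
  have hcoe : ((‖(t : ℂ)‖₊ : ℝ≥0∞)) ^ 2 = ENNReal.ofReal (t ^ 2) := by
    rw [coe_nnnorm_sq_eq_ofReal, Complex.norm_real, Real.norm_eq_abs, sq_abs]
  have hpe : eform v L gp + eform v L gm =
      2 * periodicEnergy v Ψ + 2 * (ENNReal.ofReal (t ^ 2) * eform v L ζ) := by
    rw [← hcoe, ← eform_trialState v Ψ]
    exact eform_line_add_line hv Ψ.contDiff hζ.contDiff (t : ℂ)
  have hpm : mass L gp + mass L gm = 2 * 1 + 2 * (ENNReal.ofReal (t ^ 2) * mass L ζ) := by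
    rw [← hcoe, ← mass_trialState Ψ]
    exact mass_line_add_line hψc hζc (t : ℂ)
  -- finiteness
  have h2a : 2 * periodicEnergy v Ψ ≠ ⊤ := ENNReal.mul_ne_top ENNReal.ofNat_ne_top hΨ
  have h2b : 2 * (ENNReal.ofReal (t ^ 2) * eform v L ζ) ≠ ⊤ :=
    ENNReal.mul_ne_top ENNReal.ofNat_ne_top (ENNReal.mul_ne_top ENNReal.ofReal_ne_top hζfin)
  have h2e : 2 * periodicEnergy v Ψ + 2 * (ENNReal.ofReal (t ^ 2) * eform v L ζ) ≠ ⊤ :=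
    ENNReal.add_ne_top.2 ⟨h2a, h2b⟩
  have hep : eform v L gp ≠ ⊤ := ne_top_of_le_ne_top h2e (hpe ▸ le_self_add)
  have hem : eform v L gm ≠ ⊤ := ne_top_of_le_ne_top h2e (hpe ▸ le_add_self)
  have hmζ : mass L ζ ≠ ⊤ := mass_ne_top_of_continuous hζc
  have hmp : mass L gp ≠ ⊤ :=
    mass_ne_top_of_continuous (ζ := gp) (hψc.add (continuous_const.mul hζc))
  have hmm : mass L gm ≠ ⊤ :=
    mass_ne_top_of_continuous (ζ := gm) (hψc.sub (continuous_const.mul hζc))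
  have h2c : (2 : ℝ≥0∞) * 1 ≠ ⊤ := ENNReal.mul_ne_top ENNReal.ofNat_ne_top ENNReal.one_ne_top
  have h2d : 2 * (ENNReal.ofReal (t ^ 2) * mass L ζ) ≠ ⊤ :=
    ENNReal.mul_ne_top ENNReal.ofNat_ne_top (ENNReal.mul_ne_top ENNReal.ofReal_ne_top hmζ)
  -- (1) and (2): the parallelogram laws in `ℝ`
  have h1 : (eform v L gp).toReal + (eform v L gm).toReal =
      2 * (periodicEnergy v Ψ).toReal + 2 * t ^ 2 * (eform v L ζ).toReal := by
    have h := congrArg ENNReal.toReal hpe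
    rw [ENNReal.toReal_add hep hem, ENNReal.toReal_add h2a h2b, ENNReal.toReal_mul,
      ENNReal.toReal_mul, ENNReal.toReal_mul, ENNReal.toReal_ofReal (sq_nonneg t),
      ENNReal.toReal_ofNat] at h
    rw [h]
    ring
  have h2 : (mass L gp).toReal + (mass L gm).toReal = 2 + 2 * t ^ 2 * (mass L ζ).toReal := by
    have h := congrArg ENNReal.toReal hpm
    rw [ENNReal.toReal_add hmp hmm, ENNReal.toReal_add h2c h2d, ENNReal.toReal_mul,
      ENNReal.toReal_mul, ENNReal.toReal_mul, ENNReal.toReal_ofReal (sq_nonneg t),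
      ENNReal.toReal_ofNat, ENNReal.toReal_one] at h
    rw [h]
    ring
  -- (3): the crude mass bounds in `ℝ`
  have hbound : ENNReal.ofReal (1 + t) * mass L Ψ.ψ + ENNReal.ofReal (t + t ^ 2) * mass L ζ ≠ ⊤ :=
    ENNReal.add_ne_top.2 ⟨ENNReal.mul_ne_top ENNReal.ofReal_ne_top (mass_ne_top_of_continuous hψc),
      ENNReal.mul_ne_top ENNReal.ofReal_ne_top hmζ⟩
  have hbound' : (ENNReal.ofReal (1 + t) * mass L Ψ.ψ +
      ENNReal.ofReal (t + t ^ 2) * mass L ζ).toReal = (1 + t) + (t + t ^ 2) * (mass L ζ).toReal := by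
    rw [ENNReal.toReal_add (ENNReal.mul_ne_top ENNReal.ofReal_ne_top (mass_ne_top_of_continuous hψc))
      (ENNReal.mul_ne_top ENNReal.ofReal_ne_top hmζ), ENNReal.toReal_mul, ENNReal.toReal_mul,
      ENNReal.toReal_ofReal (by linarith), ENNReal.toReal_ofReal (by positivity), mass_trialState,
      ENNReal.toReal_one, mul_one]
  have h3p : (mass L gp).toReal ≤ (1 + t) + (t + t ^ 2) * (mass L ζ).toReal := by
    rw [← hbound']
    exact ENNReal.toReal_mono hbound (mass_line_le hψc hζc ht.le)
  have h3m : (mass L gm).toReal ≤ (1 + t) + (t + t ^ 2) * (mass L ζ).toReal := by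
    rw [← hbound']
    exact ENNReal.toReal_mono hbound (mass_line_le_neg hψc hζc ht.le)
  -- (4): `q̃ ≥ 0` on the chords; (6): GD on the chords
  have h4p := e0_mul_mass_le_eform_toReal v hgpd hep
  have h4m := e0_mul_mass_le_eform_toReal v hgmd hem
  have h6p := gd_direction hGD hC hL hn hgpd hep
  have h6m := gd_direction hGD hC hL hn hgmd hem
  -- (7): the parallelogram law for the quadratic polynomial `σ(Ψ + tζ, Ψ + tζ)` in `ℂ`
  set S₀ : ℂ := srcPair m L n Ψ.ψ Ψ.ψ with hS₀
  set A₁ : ℂ := srcPair m L n ζ Ψ.ψ + srcPair m L n Ψ.ψ ζ with hA₁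
  set A₂ : ℂ := srcPair m L n ζ ζ with hA₂
  have hSp : srcPair m L n gp gp = (S₀ + (t : ℂ) ^ 2 * A₂) + (t : ℂ) * A₁ := by
    rw [hgp, srcPair_line_real n hψc hζc t]
    ring
  have hSm : srcPair m L n gm gm = (S₀ + (t : ℂ) ^ 2 * A₂) - (t : ℂ) * A₁ := by
    rw [hgm, srcPair_line_real_neg n hψc hζc t]
    ring
  have hpar := parallelogram_law_with_norm ℂ (S₀ + (t : ℂ) ^ 2 * A₂) ((t : ℂ) * A₁)
  have hny : ‖(t : ℂ) * A₁‖ = t * ‖A₁‖ := by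
    rw [norm_mul, Complex.norm_real, Real.norm_of_nonneg ht.le]
  have h7 : 2 * t ^ 2 * (((m + 1 : ℕ) : ℝ) * ‖A₁‖) ^ 2 ≤
      (((m + 1 : ℕ) : ℝ) * ‖srcPair m L n gp gp‖) ^ 2 +
        (((m + 1 : ℕ) : ℝ) * ‖srcPair m L n gm gm‖) ^ 2 := by
    rw [hSp, hSm]
    have hx : 0 ≤ ‖S₀ + (t : ℂ) ^ 2 * A₂‖ ^ 2 := sq_nonneg _
    have hN : 0 ≤ (((m + 1 : ℕ) : ℝ)) ^ 2 := sq_nonneg _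
    rw [hny] at hpar
    nlinarith [hpar, mul_nonneg hN hx]
  exact kls_arith ht hΓ0 h1 h2 h3p h3m h4p h4m h6p h6m h7

end ChordVariation

/-- **Part 3 of `stub_chordVariation` (registered helper statement)**: Gaussian domination (all `s ≥ 0`,
all trial states) gives, for every direction `f` of finite energy form, the homogeneous square form
`(N|σ(f,f)|)² ≤ C L²/‖n‖² · ‖f‖² · (𝓔(f) − E₀‖f‖²)`. [folklore] -/
theorem chordVariation_gd_direction :
    ∀ (m : ℕ) (L : ℝ) (v : ℝ → ENNReal) (n : Fin 3 → ℤ) (C : ℝ),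
      (∀ s : ℝ, 0 ≤ s →
        ∀ Φ : Literature.MathematicalPhysics.QuantumManyBody.BoseGas.PeriodicTrialState (m + 1) L,
          Summit.AtomisticToContinuum.BoseEinsteinCondensation.Theorems.GaussianDominationCan.Negative.GDIneq
            v m L n C s Φ) →
      0 < C → 0 < L → n ≠ 0 →
      ∀ f : Literature.MathematicalPhysics.QuantumManyBody.BoseGas.Config (m + 1) → ℂ,
        IsDirection m L f → eform v L f ≠ ⊤ →
          (((m + 1 : ℕ) : ℝ) * ‖srcPair m L n f f‖) ^ 2 ≤
            C * L ^ 2 / ‖(fun j => (n j : ℝ))‖ ^ 2 * (mass L f).toReal *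
              ((eform v L f).toReal -
                (Literature.MathematicalPhysics.QuantumManyBody.BoseGas.periodicGroundStateEnergy
                  v (m + 1) L).toReal * (mass L f).toReal) :=
  fun _ _ _ _ _ hGD hC hL hn _ hf hfin => ChordVariation.gd_direction hGD hC hL hn hf hfin

end Summit.AtomisticToContinuum.BoseEinsteinCondensation.Cruxes.GDTransfer.DysonDressedWitness

end
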